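import Literature.NumberTheory.NumberFields.IntegralBasisCriterion
import HarnessLib

/-!
# Integral bases from the discriminant of an arbitrary family (Marcus, Ch. 2, Exercise 27 (c)–(e))

Topic `NumberTheory/NumberFields`, namespace `Literature.NumberTheory.NumberFields`.  Companion of
`IntegralBasisCriterion.lean`, which treats POWER bases `1, θ, …, θⁿ⁻¹` (`indexDet`); here the same
change-of-basis argument is run for ANY family `v : ι → 𝓞 K` of `n = [K : ℚ]` algebraic integers —
the form needed when the maximal order is not monogenic in the generator at hand (e.g. the basis
`1, θ, (θ - 2)²/7` of the trace-`76` Cappell–Shaneson field, `CappellShanesonSeventysixIntegers.lean`).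
D. A. Marcus, *Number Fields*, 2nd ed. (2018), Ch. 2, Exercise 27: "(c) … `disc(α₁, …, αₙ) =
|G/H|² disc(G)`"; "(d) … `α₁, …, αₙ ∈ R` form an integral basis for `R` iff `disc(α₁, …, αₙ) =
disc(R)`"; "(e) … if `disc(α₁, …, αₙ)` is squarefree, then the `αᵢ` form an integral basis".

* `discr_family_eq_det_sq_mul_discr` (PROVED): with `b` an integral basis reindexed by `ι`,
  `disc_ℚ(v) = (b.det v)² · d_K`;
* `isUnit_det_family_of_discr_eq` / `isUnit_det_family_of_squarefree` (PROVED): if `disc_ℚ(v) = d`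
  and every factorisation `d = r²e` with `|e| > 2` has `r = ±1` (e.g. `d` squarefree), then
  `b.det v = ±1` (`|d_K| > 2`, Hermite–Minkowski, as in the power-basis file);
* `mem_span_family_of_isUnit_det`, `linearIndependent_family_of_isUnit_det`,
  `exists_sum_smul_eq_of_isUnit_det` (PROVED): then `v` is a `ℤ`-basis of `𝓞 K`;
* `discr_eq_of_isUnit_det_family` (PROVED): and `d_K = d`;
* `card_chooseBasisIndex_eq_finrank`: an integral basis has `[K : ℚ]` elements.

All theorems; no definitions, no named facts.

## References

* [Marcus2018] D. A. Marcus, *Number Fields*, Universitext, 2nd ed., Springer (2018), Ch. 2,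
  Thm. 9 and Exercise 27 (c)–(e).
-/

noncomputable section

open scoped NumberField
open Module NumberField Polynomial

namespace Literature.NumberTheory.NumberFields

variable {K : Type*} [Field K] [NumberField K]

/-! ### Families: Marcus, Ch. 2, Exercise 27 (c)–(e) for an arbitrary family of algebraic integers

The same change-of-basis argument for ANY family `v : ι → 𝓞 K` indexed by a type in bijection with
an integral-basis index — e.g. `1, θ, η` for a cubic field whose maximal order is not `ℤ[θ]`
(Marcus, Ch. 2, Exercise 27: "(c) … `disc(α₁, …, αₙ) = |G/H|² disc(R)`", "(d) … form an integral
basis for `R` iff `disc(α₁, …, αₙ) = disc(R)`", "(e) … if `disc(α₁, …, αₙ)` is squarefree, then the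
`αᵢ` form an integral basis"): with `b` an integral basis reindexed by `ι`,
`disc_ℚ(v) = (b.det v)² · d_K` (`discr_family_eq_det_sq_mul_discr`); if `disc_ℚ(v) = d` satisfies
the square-factor condition then `b.det v = ±1` (`isUnit_det_family_of_discr_eq`), `v` is a
`ℤ`-basis of `𝓞 K` (`mem_span_family_of_isUnit_det`, `linearIndependent_family_of_isUnit_det`)
and `d_K = d` (`discr_eq_of_isUnit_det_family`). -/

section Family

variable {ι : Type*} [Fintype ι] [DecidableEq ι]

/-- **Marcus, Ch. 2, Exercise 27(c) for a family of algebraic integers**: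
`disc_ℚ(v₁, …, vₙ) = det(coordinates of the vᵢ on an integral basis)² · d_K`.
[cite: Marcus2018, Ch. 2, Exercise 27(c)] -/
theorem discr_family_eq_det_sq_mul_discr (e : Free.ChooseBasisIndex ℤ (𝓞 K) ≃ ι) (v : ι → 𝓞 K) :
    Algebra.discr ℚ (fun i => ((v i : 𝓞 K) : K)) =
      ((((RingOfIntegers.basis K).reindex e).det v : ℤ) : ℚ) ^ 2 * NumberField.discr K := by
  set b' : Basis ι ℚ K := (NumberField.integralBasis K).reindex e with hb'
  have hdisc' : Algebra.discr ℚ ⇑b' = NumberField.discr K := by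
    rw [hb', Basis.coe_reindex, Algebra.discr_reindex, NumberField.coe_discr]
  set w : ι → K := fun i => ((v i : 𝓞 K) : K) with hw
  set P := b'.toMatrix w with hP
  have hvec : Matrix.vecMul ⇑b' (P.map (algebraMap ℚ K)) = w := b'.toMatrix_map_vecMul _
  have key : Algebra.discr ℚ w = P.det ^ 2 * NumberField.discr K := by
    rw [← hdisc', ← hvec, Algebra.discr_of_matrix_vecMul]
  have hPint : P = (((RingOfIntegers.basis K).reindex e).toMatrix v).map (Int.castRingHom ℚ) := by
    ext i j
    rw [hP, Basis.toMatrix_apply, Matrix.map_apply, Basis.toMatrix_apply, hw, hb',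
      Basis.repr_reindex, Finsupp.mapDomain_equiv_apply, NumberField.integralBasis_repr_apply,
      Basis.repr_reindex, Finsupp.mapDomain_equiv_apply]
    rfl
  rw [key, hPint, ← RingHom.mapMatrix_apply, ← RingHom.map_det, Basis.det_apply, eq_intCast]

/-- **Marcus, Ch. 2, Exercise 27(e) for a family** (sharpened by Hermite–Minkowski as above): if
`disc_ℚ(v) = d` and every factorisation `d = r² e` with `|e| > 2` has `r = ±1`, then the
determinant of the coordinates of `v` on an integral basis is a unit. [cite: Marcus2018, Ch. 2, Exercise 27(e)] -/
theorem isUnit_det_family_of_discr_eq (e : Free.ChooseBasisIndex ℤ (𝓞 K) ≃ ι) (v : ι → 𝓞 K)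
    (h1 : 1 < finrank ℚ K) (d : ℤ) (hd : Algebra.discr ℚ (fun i => ((v i : 𝓞 K) : K)) = d)
    (h : ∀ r e' : ℤ, d = r ^ 2 * e' → 2 < |e'| → IsUnit r) :
    IsUnit (((RingOfIntegers.basis K).reindex e).det v) := by
  refine h _ (NumberField.discr K) ?_ (NumberField.abs_discr_gt_two h1)
  have := discr_family_eq_det_sq_mul_discr e v
  rw [hd] at this
  exact_mod_cast this

/-- A squarefree `disc_ℚ(v)` qualifies. [cite: Marcus2018, Ch. 2, Exercise 27(e)] -/
theorem isUnit_det_family_of_squarefree (e : Free.ChooseBasisIndex ℤ (𝓞 K) ≃ ι) (v : ι → 𝓞 K)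
    (h1 : 1 < finrank ℚ K) (d : ℤ) (hd : Algebra.discr ℚ (fun i => ((v i : 𝓞 K) : K)) = d)
    (hsq : Squarefree d) : IsUnit (((RingOfIntegers.basis K).reindex e).det v) := by
  refine isUnit_det_family_of_discr_eq e v h1 d hd fun r e' hre _ => ?_
  exact hsq r ⟨e', by rw [hre]; ring⟩

/-- **Marcus, Ch. 2, Exercise 27(d) for a family**: if that determinant is a unit, the family
spans `𝓞 K` over `ℤ` — every algebraic integer is an integer combination of the `vᵢ`.
[cite: Marcus2018, Ch. 2, Exercise 27(d)] -/
theorem mem_span_family_of_isUnit_det (e : Free.ChooseBasisIndex ℤ (𝓞 K) ≃ ι) (v : ι → 𝓞 K)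
    (h : IsUnit (((RingOfIntegers.basis K).reindex e).det v)) (x : 𝓞 K) :
    x ∈ Submodule.span ℤ (Set.range v) := by
  have hb := (((RingOfIntegers.basis K).reindex e).is_basis_iff_det (v := v)).mpr h
  rw [hb.2]
  exact Submodule.mem_top

/-- … and the family is linearly independent over `ℤ` (so it is an integral basis).
[cite: Marcus2018, Ch. 2, Exercise 27(d)] -/
theorem linearIndependent_family_of_isUnit_det (e : Free.ChooseBasisIndex ℤ (𝓞 K) ≃ ι)
    (v : ι → 𝓞 K) (h : IsUnit (((RingOfIntegers.basis K).reindex e).det v)) :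
    LinearIndependent ℤ v :=
  ((((RingOfIntegers.basis K).reindex e).is_basis_iff_det (v := v)).mpr h).1

/-- … and every algebraic integer has coordinates on the family: `x = ∑ cᵢ vᵢ` with `cᵢ ∈ ℤ`.
[cite: Marcus2018, Ch. 2, Exercise 27(d)] -/
theorem exists_sum_smul_eq_of_isUnit_det (e : Free.ChooseBasisIndex ℤ (𝓞 K) ≃ ι) (v : ι → 𝓞 K)
    (h : IsUnit (((RingOfIntegers.basis K).reindex e).det v)) (x : 𝓞 K) :
    ∃ c : ι → ℤ, ∑ i, c i • v i = x :=
  Submodule.mem_span_range_iff_exists_fun ℤ |>.mp (mem_span_family_of_isUnit_det e v h x)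

/-- … and `d_K = disc_ℚ(v)` ("iff the discriminants are equal"). [cite: Marcus2018, Ch. 2, Exercise 27(d)] -/
theorem discr_eq_of_isUnit_det_family (e : Free.ChooseBasisIndex ℤ (𝓞 K) ≃ ι) (v : ι → 𝓞 K)
    (h : IsUnit (((RingOfIntegers.basis K).reindex e).det v)) (d : ℤ)
    (hd : Algebra.discr ℚ (fun i => ((v i : 𝓞 K) : K)) = d) : NumberField.discr K = d := by
  have key := discr_family_eq_det_sq_mul_discr e v
  have h1 : ((((RingOfIntegers.basis K).reindex e).det v : ℤ) : ℚ) ^ 2 = 1 := by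
    rcases Int.isUnit_iff.mp h with h' | h' <;> simp [h']
  rw [hd, h1, one_mul] at key
  exact_mod_cast key.symm

/-- An integral basis has `n = [K : ℚ]` elements (so families indexed by `Fin n` qualify, through
`Fintype.equivOfCardEq`). [cite: Marcus2018, Ch. 2, Thm. 9 and Cor. (an integral basis has `n` elements)] -/
theorem card_chooseBasisIndex_eq_finrank :
    Fintype.card (Free.ChooseBasisIndex ℤ (𝓞 K)) = finrank ℚ K := by
  rw [← finrank_eq_card_basis (NumberField.integralBasis K)]

end Family

end Literature.NumberTheory.NumberFields

end
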